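import Summits.HodgeConjecture.HodgeConjecture.Theorems.F0P3SpectralPacketRigidityReduction   -- ★ LH7-p03 p847962: `xiRigidityGHom_of_marker_laws`, `false_of_allL_of_mem` (+ ★ 3w `XiRigidityGHom`, `piXiHm`)
import Summits.HodgeConjecture.HodgeConjecture.Theorems.F0P3SpectralPacketCoherent            -- ★ (N) FILE 3v: `IsSignedPacketOf.evpGψ_eq_of_not_mem`, `.unr_of_not_mem` (+ ★ 3s `evpAtψ_eq_eigencharacter_of_mem`, ★ 3i `evpAtψ_of_test`, ★ `F0P3EigencharacterTransport`)
import Literature.NumberTheory.Automorphic.IrrClassEigencharacter                             -- ★ `IrrClass.eq_of_eigencharacter_eq` (Satake injectivity, CartierCorvallis1979 §IV.1 Cor. 4.1)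
import Literature.NumberTheory.Automorphic.LocalUnitaryIntegralLevel                          -- ★ `isCompact_isOpen_cmLocalIntegralLevel`
import HarnessLib

/-!
# SPHERICAL RIGIDITY AT ONE PLACE — the e.v.p. PINS the unramified member: `t(Q)_v = t(πⁿ(ξ_v))` ⇒ `πⁿ(ξ_v) ∈ Q_v` (Satake injectivity), and the ALL-L half of (L1″) `XiRigidityGHom`
# discharged in-house — kit-generic (Rogawski §13.7 p. 206; Cartier, Corvallis §IV.1 Cor. 4.1; §13.3 Thm. 13.3.5, p. 199 ¶2)

Cell `hodgecm-mathlib`, F0∕P3c line LH7 (closer stub `stub_PKtuple : PKtupleLetter`, `Cruxes/H413/Lines/F0_U3LettersRung1.lean` ED. 38 «PK-ε», row #181),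
crux H413 = `stmt-HodgeConjecture-24833`; organ payer LH7-p03 (g0), DEFAULT organ «SATAKE-AT-ONE-PLACE» (the hypothesis `hL` of ★ `xiRigidityGHom_of_marker_laws`, p847962).
`--supports stmt-HodgeConjecture-24833`; closes no stub.

THE MATHEMATICS.  ★ 3s (s0b) `evpAtψ_eq_eigencharacter_of_mem` computes the e.v.p. slot of a packet whose token at `v` CONTAINS the transport `π′ ∘ ψ_v⁻¹` of a `K′_v`-spherical
admissible class `π′` of `G′_v`: it is the normalised eigencharacter `t_{π′}`.  This file proves the CONVERSE: if `Q_v` is unramified (so its e.v.p. is the eigencharacter of THE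
unramified member `π_v⁰ = sph`, (ℓ4) `UnramLaw`) and the slot EQUALS `t_{π′}`, then `π_v⁰ ∘ ψ_v` and `π′` are two admissible `K′_v`-spherical classes of `G′_v` with the same
character of the spherical Hecke algebra `ℋ(G′_v, K′_v)`, hence EQUAL [CartierCorvallis1979 §IV.1 Cor. 4.1: a spherical irreducible is determined by its Hecke character —
★ `IrrClass.eq_of_eigencharacter_eq`; `vol(K′_v) ≠ 0`]; so `π′ ∘ ψ_v⁻¹ = π_v⁰ ∈ Q_v` [Rogawski1990 §13.7 p. 206 «the e.v.p. `t(Π)` … separates»; §13.3 p. 203 l. 3].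
CONSEQUENCE for (PK-A-G): in (L1″) `XiRigidityGHom hXiS ψ νG tXi` the antecedent `EqOff L H S (Q.evpGψ ψ νG) (tXi ξ)` with `ramG Q ⊆ S`, read against the record e.v.p.
`tXi ξ v = t_{πⁿ(ξ_v)}` off `ram ξ` (★ `xiEvpOfRecordSCD`, by `rfl` at the record; here the hypothesis `ht`), gives `πⁿ(ξ_v) ∘ ψ_v⁻¹ ∈ Q_v` at EVERY `v ∉ S ∪ S₀ ∪ ram ξ` — in
particular at SOME place (a number field has infinitely many, ★ `infinite_heightOneSpectrum`).  That is exactly the hypothesis `hL` of ★ `xiRigidityGHom_of_marker_laws` (p847962),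
so the ALL-L half of rigidity-G is IN-HOUSE: §3 `xiRigidityGHom_of_marker_laws_of_meet` keeps only the all-A member fact `hA` (Thm. 13.3.6 (c) at the finitely many places of
`S ∪ S₀ ∪ ram ξ`; off them it is supplied here too, §2 `πn_mem_of_eqOff`).

CONTENTS:
* §1 (one place, `GlobalPacket` level) `sph_comap_eq_of_evpAtψ_eq` (`π_v⁰ ∘ ψ_v = π′`), `sph_eq_comap_symm_of_evpAtψ_eq`, `comap_symm_mem_of_evpAtψ_eq` (`π′ ∘ ψ_v⁻¹ ∈ Π_v`);
  `measureReal_ne_zero_of_eq_one` (binder 33 `ν′_v(K′_v) = 1` ⇒ `vol ≠ 0`).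
* §2 (`SpectralPacketG` level, the letter's slots) `πn_mem_of_evpGψ_eq` (one place), `πn_mem_of_eqOff` (every `v ∉ S ∪ S₀ ∪ ram` from `EqOff … t` + `ht`), `exists_πn_mem_of_eqOff`.
* §3 `xiRigidityGHom_of_marker_laws_of_meet` — (L1″) from (KM1)(KJ-G)(KM2)(KM3) + (KG1) + (KG3′)-at-`sph` + `hψK` off `S₀` + `vol(K′_v) ≠ 0` + the record shapes `hsph`∕`hadmn`∕`ht` + the ONE
  print input `hA` («an all-A coherent `Q` with the ξ-germ meets `Π(ξ_v)` at every place», Thm. 13.3.6 (c)).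
No instance, no notation, no named fact, no `sorry`.
HONEST LABEL: HC_CM is proved only modulo the 7 printed citations (2 remaining: hLiu418 = stmt-HodgeConjecture-24832, h413 = stmt-HodgeConjecture-24833) until rung 0 closes;
this file proves no printed statement — it discharges the all-L half of the rigidity conjunct of (PK-A-G) kit-generically and isolates Thm. 13.3.6 (c) as the remaining input.

References: [Rogawski1990] §13.7 p. 206; §13.3 p. 203 l. 1–3, Thm. 13.3.5 p. 202, Thm. 13.3.6 (c) p. 202, p. 199 ¶2; §12.2 p. 174 l. 1; §14.2 p. 232.  [CartierCorvallis1979] §IV.1 Cor. 4.1.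
-/

set_option autoImplicit false
-- the mandated namespace repeats `HodgeConjecture.HodgeConjecture`, as in every `Theorems/*.lean` of this sub-problem
set_option linter.dupNamespace false

noncomputable section

open NumberField IsDedekindDomain MeasureTheory
open scoped Matrix MatrixGroups

open Literature.NumberTheory Literature.NumberTheory.Automorphic Literature.NumberTheory.Automorphic.UnitaryGroup
open Literature.NumberTheory.Rogawski1990 Literature.NumberTheory.GaloisRepresentations
open Literature.RepresentationTheory.BorelWallach2000 Literature.RepresentationTheory.KonnoKonno2007
open Summit.HodgeConjecture.HodgeConjecture.Cruxes.H413.F0P3InnerFormClassificationV6 (splitForm EvpData EqOff)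
open Summit.HodgeConjecture.HodgeConjecture.Cruxes.H413.F0P3LocalPacketKit
open Summit.HodgeConjecture.HodgeConjecture.Cruxes.H413.F0P3ArchPacketKit
open Summit.HodgeConjecture.HodgeConjecture.Cruxes.H413.F0P3EigencharacterTransport (eigencharacter_comap_of_map_eq)

/-! ## §1 One place: the e.v.p. pins the unramified member [§13.7 p. 206; Cartier §IV.1 Cor. 4.1] -/

namespace Summit.HodgeConjecture.HodgeConjecture.Cruxes.H413.F0P3GlobalPacket.GlobalPacket

variable {L : Type} [Field L] [NumberField L] [IsCMField L] {H : Matrix (Fin 3) (Fin 3) L}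
  {𝔩 : ∀ v : HeightOneSpectrum (𝓞 ↥(maximalRealSubfield L)), LocalPacketKit L (splitForm L 3) v}

/-- **Binder 33 gives a non-zero level volume**: `ν′_v(K′_v) = 1 ⇒ vol_{ν′_v}(K′_v) ≠ 0` (the `μ(K) ≠ 0` input of ★ `IrrClass.eq_of_eigencharacter_eq`). [cite: Rogawski1990, §4.3 p. 44] -/
theorem measureReal_ne_zero_of_eq_one {X : Type} [MeasurableSpace X] {ν : Measure X} {K : Set X} (h : ν K = 1) : ν.real K ≠ 0 := by
  rw [measureReal_def, h, ENNReal.toReal_one]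
  exact one_ne_zero

variable [∀ v : HeightOneSpectrum (𝓞 ↥(maximalRealSubfield L)), MeasurableSpace ((cmDatum L 3 (splitForm L 3)).Local v)]
  [∀ v : HeightOneSpectrum (𝓞 ↥(maximalRealSubfield L)), BorelSpace ((cmDatum L 3 (splitForm L 3)).Local v)]
  [∀ v : HeightOneSpectrum (𝓞 ↥(maximalRealSubfield L)), MeasurableSpace ((cmDatum L 3 H).Local v)]
  [∀ v : HeightOneSpectrum (𝓞 ↥(maximalRealSubfield L)), BorelSpace ((cmDatum L 3 H).Local v)]

/-- **SATAKE INJECTIVITY AT THE SLOT — `π_v⁰ ∘ ψ_v = π′`**: if `Π_v` is unramified with admissible unramified member `π_v⁰` ((ℓ4) `UnramLaw`), `ψ_v(K′_v) = K_v`, `vol(K′_v) ≠ 0`, and the slot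
`Π.evpAtψ ψ (ψ_*ν′) v` EQUALS the normalised eigencharacter of an admissible `K′_v`-spherical class `π′` of `G′_v`, then `π_v⁰ ∘ ψ_v = π′` — two spherical classes with the same Hecke
character coincide. [cite: CartierCorvallis1979, §IV.1 Cor. 4.1] [cite: Rogawski1990, §13.7 p. 206; §13.3 p. 203 l. 3] -/
theorem sph_comap_eq_of_evpAtψ_eq (Pg : GlobalPacket 𝔩)
    (ψ : ∀ v : HeightOneSpectrum (𝓞 ↥(maximalRealSubfield L)), (cmDatum L 3 H).Local v ≃ₜ* (cmDatum L 3 (splitForm L 3)).Local v)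
    (νG' : ∀ v : HeightOneSpectrum (𝓞 ↥(maximalRealSubfield L)), Measure ((cmDatum L 3 H).Local v))
    [∀ v, (νG' v).IsMulLeftInvariant] [∀ v, IsFiniteMeasureOnCompacts (νG' v)]
    {v : HeightOneSpectrum (𝓞 ↥(maximalRealSubfield L))} (h4 : (𝔩 v).UnramLaw)
    (hψK : (cmLocalIntegralLevel L 3 H v).map (ψ v : (cmDatum L 3 H).Local v →* (cmDatum L 3 (splitForm L 3)).Local v) = cmLocalIntegralLevel L 3 (splitForm L 3) v)
    (hvol : (νG' v).real (cmLocalIntegralLevel L 3 H v : Set ((cmDatum L 3 H).Local v)) ≠ 0)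
    (hunr : (𝔩 v).unr (Pg.loc v)) (hadmS : ((𝔩 v).sph (Pg.loc v) hunr).IsAdmissible)
    {π' : IrrClass ((cmDatum L 3 H).Local v)} (hadm : π'.IsAdmissible) (hsph : π'.IsSpherical (cmLocalIntegralLevel L 3 H v))
    (heq : Pg.evpAtψ ψ (fun w => (νG' w).map (ψ w)) v = π'.eigencharacter (cmLocalIntegralLevel L 3 H v) (νG' v)) :
    IrrClass.comap (ψ v) ((𝔩 v).sph (Pg.loc v) hunr) = π' := by
  have hK := isCompact_isOpen_cmLocalIntegralLevel L 3 H v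
  -- `π_v⁰` is `K_v`-spherical, so `π_v⁰ ∘ ψ_v` is `K′_v`-spherical
  have hsphS : (IrrClass.comap (ψ v) ((𝔩 v).sph (Pg.loc v) hunr)).IsSpherical (cmLocalIntegralLevel L 3 H v) :=
    (IrrClass.isSpherical_comap_iff_of_map_eq (ψ v) _ hψK).2 (h4 (Pg.loc v) hunr).2.1
  refine IrrClass.eq_of_eigencharacter_eq (νG' v) (hadmS.comap (ψ v)) hadm hK.2 hK.1 hvol hsphS hsph ?_
  funext f
  by_cases hf : HasCompactSupport f ∧ IsLevel (cmLocalIntegralLevel L 3 H v) f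
  · rw [eigencharacter_comap_of_map_eq (ψ v) hadmS hψK (νG' v) f, ← Pg.evpAt_of_unr_eq_eigencharacter v _ hunr,
      ← Pg.evpAtψ_of_test ψ (fun w => (νG' w).map (ψ w)) hf, heq]
  · rw [IrrClass.eigencharacter_of_not _ _ _ hf, IrrClass.eigencharacter_of_not _ _ _ hf]

/-- **… read on `G_v`: `π_v⁰ = π′ ∘ ψ_v⁻¹`.** [cite: CartierCorvallis1979, §IV.1 Cor. 4.1] [cite: Rogawski1990, §13.7 p. 206] -/
theorem sph_eq_comap_symm_of_evpAtψ_eq (Pg : GlobalPacket 𝔩)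
    (ψ : ∀ v : HeightOneSpectrum (𝓞 ↥(maximalRealSubfield L)), (cmDatum L 3 H).Local v ≃ₜ* (cmDatum L 3 (splitForm L 3)).Local v)
    (νG' : ∀ v : HeightOneSpectrum (𝓞 ↥(maximalRealSubfield L)), Measure ((cmDatum L 3 H).Local v))
    [∀ v, (νG' v).IsMulLeftInvariant] [∀ v, IsFiniteMeasureOnCompacts (νG' v)]
    {v : HeightOneSpectrum (𝓞 ↥(maximalRealSubfield L))} (h4 : (𝔩 v).UnramLaw)
    (hψK : (cmLocalIntegralLevel L 3 H v).map (ψ v : (cmDatum L 3 H).Local v →* (cmDatum L 3 (splitForm L 3)).Local v) = cmLocalIntegralLevel L 3 (splitForm L 3) v)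
    (hvol : (νG' v).real (cmLocalIntegralLevel L 3 H v : Set ((cmDatum L 3 H).Local v)) ≠ 0)
    (hunr : (𝔩 v).unr (Pg.loc v)) (hadmS : ((𝔩 v).sph (Pg.loc v) hunr).IsAdmissible)
    {π' : IrrClass ((cmDatum L 3 H).Local v)} (hadm : π'.IsAdmissible) (hsph : π'.IsSpherical (cmLocalIntegralLevel L 3 H v))
    (heq : Pg.evpAtψ ψ (fun w => (νG' w).map (ψ w)) v = π'.eigencharacter (cmLocalIntegralLevel L 3 H v) (νG' v)) :
    (𝔩 v).sph (Pg.loc v) hunr = IrrClass.comap (ψ v).symm π' := by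
  rw [← Pg.sph_comap_eq_of_evpAtψ_eq ψ νG' h4 hψK hvol hunr hadmS hadm hsph heq, IrrClass.comap_symm_comap]

/-- **… hence `π′ ∘ ψ_v⁻¹ ∈ Π_v`** (the unramified member is a member, (ℓ4)). [cite: Rogawski1990, §13.3 p. 203 l. 1–3; §13.7 p. 206] [cite: CartierCorvallis1979, §IV.1 Cor. 4.1] -/
theorem comap_symm_mem_of_evpAtψ_eq (Pg : GlobalPacket 𝔩)
    (ψ : ∀ v : HeightOneSpectrum (𝓞 ↥(maximalRealSubfield L)), (cmDatum L 3 H).Local v ≃ₜ* (cmDatum L 3 (splitForm L 3)).Local v)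
    (νG' : ∀ v : HeightOneSpectrum (𝓞 ↥(maximalRealSubfield L)), Measure ((cmDatum L 3 H).Local v))
    [∀ v, (νG' v).IsMulLeftInvariant] [∀ v, IsFiniteMeasureOnCompacts (νG' v)]
    {v : HeightOneSpectrum (𝓞 ↥(maximalRealSubfield L))} (h4 : (𝔩 v).UnramLaw)
    (hψK : (cmLocalIntegralLevel L 3 H v).map (ψ v : (cmDatum L 3 H).Local v →* (cmDatum L 3 (splitForm L 3)).Local v) = cmLocalIntegralLevel L 3 (splitForm L 3) v)
    (hvol : (νG' v).real (cmLocalIntegralLevel L 3 H v : Set ((cmDatum L 3 H).Local v)) ≠ 0)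
    (hunr : (𝔩 v).unr (Pg.loc v)) (hadmS : ((𝔩 v).sph (Pg.loc v) hunr).IsAdmissible)
    {π' : IrrClass ((cmDatum L 3 H).Local v)} (hadm : π'.IsAdmissible) (hsph : π'.IsSpherical (cmLocalIntegralLevel L 3 H v))
    (heq : Pg.evpAtψ ψ (fun w => (νG' w).map (ψ w)) v = π'.eigencharacter (cmLocalIntegralLevel L 3 H v) (νG' v)) :
    IrrClass.comap (ψ v).symm π' ∈ (𝔩 v).mem (Pg.loc v) := by
  rw [← Pg.sph_eq_comap_symm_of_evpAtψ_eq ψ νG' h4 hψK hvol hunr hadmS hadm hsph heq]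
  exact (h4 (Pg.loc v) hunr).1

end Summit.HodgeConjecture.HodgeConjecture.Cruxes.H413.F0P3GlobalPacket.GlobalPacket

/-! ## §2 The letter's slots: `EqOff L H S (Q.evpGψ ψ νG) t` with `t v = t_{πⁿ(ξ_v)}` off `ram` puts `πⁿ(ξ_v) ∘ ψ_v⁻¹` in `Q_v` at every `v ∉ S ∪ S₀ ∪ ram` [§13.7 p. 206] -/

namespace Summit.HodgeConjecture.HodgeConjecture.Cruxes.H413.F0P3SpectralPacket.SpectralPacketG

open Summit.HodgeConjecture.HodgeConjecture.Cruxes.H413.F0P3GlobalPacket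

variable {L : Type} [Field L] [NumberField L] [IsCMField L] {H : Matrix (Fin 3) (Fin 3) L}
  {𝔩 : ∀ v : HeightOneSpectrum (𝓞 ↥(maximalRealSubfield L)), LocalPacketKit L (splitForm L 3) v} {𝔞 : ArchPacketKit}
  {μ : Measure (adelicGroupData (↥(maximalRealSubfield L)) L (IsCMField.complexConj L) 3 (splitForm L 3)).automorphicQuotient}
  [SMulInvariantMeasure (adelicGroupData (↥(maximalRealSubfield L)) L (IsCMField.complexConj L) 3 (splitForm L 3)).Adelic
    (adelicGroupData (↥(maximalRealSubfield L)) L (IsCMField.complexConj L) 3 (splitForm L 3)).automorphicQuotient μ]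
  [∀ v : HeightOneSpectrum (𝓞 ↥(maximalRealSubfield L)), MeasurableSpace ((cmDatum L 3 (splitForm L 3)).Local v)]
  [∀ v : HeightOneSpectrum (𝓞 ↥(maximalRealSubfield L)), BorelSpace ((cmDatum L 3 (splitForm L 3)).Local v)]
  [∀ v : HeightOneSpectrum (𝓞 ↥(maximalRealSubfield L)), MeasurableSpace ((cmDatum L 3 H).Local v)]
  [∀ v : HeightOneSpectrum (𝓞 ↥(maximalRealSubfield L)), BorelSpace ((cmDatum L 3 H).Local v)]
  {νG' : ∀ v : HeightOneSpectrum (𝓞 ↥(maximalRealSubfield L)), Measure ((cmDatum L 3 H).Local v)}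
  [∀ v, (νG' v).IsMulLeftInvariant] [∀ v, IsFiniteMeasureOnCompacts (νG' v)]
  {ψ : ∀ v : HeightOneSpectrum (𝓞 ↥(maximalRealSubfield L)), (cmDatum L 3 H).Local v ≃ₜ* (cmDatum L 3 (splitForm L 3)).Local v}

/-- **ONE PLACE, at the slot `evpGψ`**: if `Q_v` is unramified with admissible members ((KG3′)), `ψ_v(K′_v) = K_v`, `vol(K′_v) ≠ 0`, and `Q.evpGψ ψ (ψ_*ν′) v = t_{π′}` for an admissible
`K′_v`-spherical `π′`, then `π′ ∘ ψ_v⁻¹ ∈ Q_v`. [cite: CartierCorvallis1979, §IV.1 Cor. 4.1] [cite: Rogawski1990, §13.7 p. 206; §13.3 p. 203 l. 1–3] -/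
theorem comap_symm_mem_of_evpGψ_eq (Q : SpectralPacketG 𝔩 𝔞 μ) {v : HeightOneSpectrum (𝓞 ↥(maximalRealSubfield L))} (h4 : (𝔩 v).UnramLaw)
    (hadmQ : ∀ π ∈ (𝔩 v).mem (Q.fin.loc v), π.IsAdmissible)
    (hψK : (cmLocalIntegralLevel L 3 H v).map (ψ v : (cmDatum L 3 H).Local v →* (cmDatum L 3 (splitForm L 3)).Local v) = cmLocalIntegralLevel L 3 (splitForm L 3) v)
    (hvol : (νG' v).real (cmLocalIntegralLevel L 3 H v : Set ((cmDatum L 3 H).Local v)) ≠ 0)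
    (hunr : (𝔩 v).unr (Q.fin.loc v))
    {π' : IrrClass ((cmDatum L 3 H).Local v)} (hadm : π'.IsAdmissible) (hsph : π'.IsSpherical (cmLocalIntegralLevel L 3 H v))
    (heq : Q.evpGψ ψ (fun w => (νG' w).map (ψ w)) v = π'.eigencharacter (cmLocalIntegralLevel L 3 H v) (νG' v)) :
    IrrClass.comap (ψ v).symm π' ∈ (𝔩 v).mem (Q.fin.loc v) := by
  rw [Q.evpGψ_eq_evpAtψ] at heq
  exact Q.fin.comap_symm_mem_of_evpAtψ_eq ψ νG' h4 hψK hvol hunr (hadmQ _ (h4 _ hunr).1) hadm hsph heq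

variable {Pk' : OneDimAutRepH L → ∀ v : HeightOneSpectrum (𝓞 ↥(maximalRealSubfield L)), CMLocalAPacket L H v}
  {ram : OneDimAutRepH L → Finset (HeightOneSpectrum (𝓞 ↥(maximalRealSubfield L)))}

/-- **EVERY GOOD PLACE**: under (KG1) and (KG3′), with `ψ_v(K′_v) = K_v` off `S₀`, `vol(K′_v) ≠ 0`, the record facts «`πⁿ(ξ_v)` is admissible and `K′_v`-spherical off `ram ξ`» and the record
e.v.p. «`t ξ v = t_{πⁿ(ξ_v)}` off `ram ξ`»: if `t(Q) = t(ξ)` off `S ⊇ ramG Q`, then `πⁿ(ξ_v) ∘ ψ_v⁻¹ ∈ Q_v` for every `v ∉ S ∪ S₀ ∪ ram ξ`.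
[cite: Rogawski1990, §13.7 p. 206; §13.3 Thm. 13.3.5 p. 202, p. 203 l. 1–3; §12.2 p. 174 l. 1] [cite: CartierCorvallis1979, §IV.1 Cor. 4.1] -/
theorem πn_mem_of_eqOff (h4 : ∀ v : HeightOneSpectrum (𝓞 ↥(maximalRealSubfield L)), (𝔩 v).UnramLaw)
    (hKG3 : ∀ (v : HeightOneSpectrum (𝓞 ↥(maximalRealSubfield L))) (P : (𝔩 v).Pkt), ∀ π ∈ (𝔩 v).mem P, π.IsAdmissible)
    (S₀ : Finset (HeightOneSpectrum (𝓞 ↥(maximalRealSubfield L))))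
    (hψK : ∀ v ∉ S₀, (cmLocalIntegralLevel L 3 H v).map (ψ v : (cmDatum L 3 H).Local v →* (cmDatum L 3 (splitForm L 3)).Local v) =
      cmLocalIntegralLevel L 3 (splitForm L 3) v)
    (hvol : ∀ v : HeightOneSpectrum (𝓞 ↥(maximalRealSubfield L)), (νG' v).real (cmLocalIntegralLevel L 3 H v : Set ((cmDatum L 3 H).Local v)) ≠ 0)
    (hsph : ∀ (ξ : OneDimAutRepH L), ∀ v ∉ ram ξ, (Pk' ξ v).πn.IsSpherical (cmLocalIntegralLevel L 3 H v))
    (hadmn : ∀ (ξ : OneDimAutRepH L) (v : HeightOneSpectrum (𝓞 ↥(maximalRealSubfield L))), (Pk' ξ v).πn.IsAdmissible)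
    {t : OneDimAutRepH L → EvpData L H}
    (ht : ∀ (ξ : OneDimAutRepH L), ∀ v ∉ ram ξ, t ξ v = (Pk' ξ v).πn.eigencharacter (cmLocalIntegralLevel L 3 H v) (νG' v))
    (ξ : OneDimAutRepH L) {S : Finset (HeightOneSpectrum (𝓞 ↥(maximalRealSubfield L)))} {Q : SpectralPacketG 𝔩 𝔞 μ}
    (hevp : EqOff L H S (Q.evpGψ ψ (fun w => (νG' w).map (ψ w))) (t ξ)) (hram : Q.fin.ramFinset ⊆ S)
    {v : HeightOneSpectrum (𝓞 ↥(maximalRealSubfield L))} (hvS : v ∉ S) (hv₀ : v ∉ S₀) (hvr : v ∉ ram ξ) :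
    IrrClass.comap (ψ v).symm (Pk' ξ v).πn ∈ (𝔩 v).mem (Q.fin.loc v) :=
  Q.comap_symm_mem_of_evpGψ_eq (h4 v) (hKG3 v _) (hψK v hv₀) (hvol v) (Q.fin.unr_of_not_mem_ramFinset fun h => hvS (hram h)) (hadmn ξ v) (hsph ξ v hvr)
    ((hevp v hvS).trans (ht ξ v hvr))

/-- **… in the transported currency**: `(transportAPackets ψ Pk′ ξ v).πn ∈ Q_v` for every `v ∉ S ∪ S₀ ∪ ram ξ`. [cite: Rogawski1990, §13.7 p. 206; §14.2 p. 232] [cite: CartierCorvallis1979, §IV.1 Cor. 4.1] -/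
theorem transport_πn_mem_of_eqOff (h4 : ∀ v : HeightOneSpectrum (𝓞 ↥(maximalRealSubfield L)), (𝔩 v).UnramLaw)
    (hKG3 : ∀ (v : HeightOneSpectrum (𝓞 ↥(maximalRealSubfield L))) (P : (𝔩 v).Pkt), ∀ π ∈ (𝔩 v).mem P, π.IsAdmissible)
    (S₀ : Finset (HeightOneSpectrum (𝓞 ↥(maximalRealSubfield L))))
    (hψK : ∀ v ∉ S₀, (cmLocalIntegralLevel L 3 H v).map (ψ v : (cmDatum L 3 H).Local v →* (cmDatum L 3 (splitForm L 3)).Local v) =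
      cmLocalIntegralLevel L 3 (splitForm L 3) v)
    (hvol : ∀ v : HeightOneSpectrum (𝓞 ↥(maximalRealSubfield L)), (νG' v).real (cmLocalIntegralLevel L 3 H v : Set ((cmDatum L 3 H).Local v)) ≠ 0)
    (hsph : ∀ (ξ : OneDimAutRepH L), ∀ v ∉ ram ξ, (Pk' ξ v).πn.IsSpherical (cmLocalIntegralLevel L 3 H v))
    (hadmn : ∀ (ξ : OneDimAutRepH L) (v : HeightOneSpectrum (𝓞 ↥(maximalRealSubfield L))), (Pk' ξ v).πn.IsAdmissible)
    {t : OneDimAutRepH L → EvpData L H}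
    (ht : ∀ (ξ : OneDimAutRepH L), ∀ v ∉ ram ξ, t ξ v = (Pk' ξ v).πn.eigencharacter (cmLocalIntegralLevel L 3 H v) (νG' v))
    (ξ : OneDimAutRepH L) {S : Finset (HeightOneSpectrum (𝓞 ↥(maximalRealSubfield L)))} {Q : SpectralPacketG 𝔩 𝔞 μ}
    (hevp : EqOff L H S (Q.evpGψ ψ (fun w => (νG' w).map (ψ w))) (t ξ)) (hram : Q.fin.ramFinset ⊆ S)
    {v : HeightOneSpectrum (𝓞 ↥(maximalRealSubfield L))} (hvS : v ∉ S) (hv₀ : v ∉ S₀) (hvr : v ∉ ram ξ) :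
    (transportAPackets ψ Pk' ξ v).πn ∈ (𝔩 v).mem (Q.fin.loc v) := by
  rw [transportAPackets_πn]
  exact πn_mem_of_eqOff h4 hKG3 S₀ hψK hvol hsph hadmn ht ξ hevp hram hvS hv₀ hvr

/-- **SOME PLACE** (a number field has infinitely many finite places, ★ `infinite_heightOneSpectrum`): under the same hypotheses `∃ v, (transportAPackets ψ Pk′ ξ v).πn ∈ Q_v` — the
hypothesis `hL` of ★ `xiRigidityGHom_of_marker_laws` for EVERY packet with the ξ-germ (all-L or not). [cite: Rogawski1990, §13.7 p. 206; §13.3 p. 199 ¶2] [cite: CartierCorvallis1979, §IV.1 Cor. 4.1] -/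
theorem exists_transport_πn_mem_of_eqOff (h4 : ∀ v : HeightOneSpectrum (𝓞 ↥(maximalRealSubfield L)), (𝔩 v).UnramLaw)
    (hKG3 : ∀ (v : HeightOneSpectrum (𝓞 ↥(maximalRealSubfield L))) (P : (𝔩 v).Pkt), ∀ π ∈ (𝔩 v).mem P, π.IsAdmissible)
    (S₀ : Finset (HeightOneSpectrum (𝓞 ↥(maximalRealSubfield L))))
    (hψK : ∀ v ∉ S₀, (cmLocalIntegralLevel L 3 H v).map (ψ v : (cmDatum L 3 H).Local v →* (cmDatum L 3 (splitForm L 3)).Local v) =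
      cmLocalIntegralLevel L 3 (splitForm L 3) v)
    (hvol : ∀ v : HeightOneSpectrum (𝓞 ↥(maximalRealSubfield L)), (νG' v).real (cmLocalIntegralLevel L 3 H v : Set ((cmDatum L 3 H).Local v)) ≠ 0)
    (hsph : ∀ (ξ : OneDimAutRepH L), ∀ v ∉ ram ξ, (Pk' ξ v).πn.IsSpherical (cmLocalIntegralLevel L 3 H v))
    (hadmn : ∀ (ξ : OneDimAutRepH L) (v : HeightOneSpectrum (𝓞 ↥(maximalRealSubfield L))), (Pk' ξ v).πn.IsAdmissible)
    {t : OneDimAutRepH L → EvpData L H}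
    (ht : ∀ (ξ : OneDimAutRepH L), ∀ v ∉ ram ξ, t ξ v = (Pk' ξ v).πn.eigencharacter (cmLocalIntegralLevel L 3 H v) (νG' v))
    (ξ : OneDimAutRepH L) {S : Finset (HeightOneSpectrum (𝓞 ↥(maximalRealSubfield L)))} {Q : SpectralPacketG 𝔩 𝔞 μ}
    (hevp : EqOff L H S (Q.evpGψ ψ (fun w => (νG' w).map (ψ w))) (t ξ)) (hram : Q.fin.ramFinset ⊆ S) :
    ∃ v : HeightOneSpectrum (𝓞 ↥(maximalRealSubfield L)), (transportAPackets ψ Pk' ξ v).πn ∈ (𝔩 v).mem (Q.fin.loc v) := by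
  classical
  haveI : Infinite (HeightOneSpectrum (𝓞 ↥(maximalRealSubfield L))) := Literature.NumberTheory.Automorphic.infinite_heightOneSpectrum _
  obtain ⟨v, hv⟩ := Infinite.exists_notMem_finset (S ∪ S₀ ∪ ram ξ)
  simp only [Finset.mem_union, not_or] at hv
  exact ⟨v, transport_πn_mem_of_eqOff h4 hKG3 S₀ hψK hvol hsph hadmn ht ξ hevp hram hv.1.1 hv.1.2 hv.2⟩

/-! ## §3 (L1″) with the all-L half in-house: only Thm. 13.3.6 (c) (all-A, «meets everywhere») remains an input [Thm. 13.3.5, 13.3.6 (c)] -/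

variable {infOf : GlobalPacket 𝔩 → 𝔞.PktInf} {aTok : ∀ v : HeightOneSpectrum (𝓞 ↥(maximalRealSubfield L)), Set (𝔩 v).Pkt}
  {PkInf : OneDimAutRepH L → LocalAPacket (GKIrrClass (uFormGroup (Fin 2) (Fin 1)))} {κ : OneDimAutRepH L → ℤ}

/-- **(L1″) `XiRigidityGHom` FROM THE MARKER LAWS, THE KIT∕RECORD FACTS, AND Thm. 13.3.6 (c) ALONE**: ★ `xiRigidityGHom_of_marker_laws` (p847962) with its all-L hypothesis `hL` DISCHARGED by
§2 (Satake injectivity at one good place).  Remaining named input `hA`: every coherent all-A packet with the ξ-germ off `S ⊇ ramG` MEETS `Π(ξ_v)` at EVERY place — print Thm. 13.3.6 (c)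
(its discrete member `π′` has `π′_v ≅ πⁿ(ξ_v)` at the good places by §2, hence `π′ ∈ Π(ξ)`); off `S ∪ S₀ ∪ ram ξ` §2 already supplies it.
[cite: Rogawski1990, §13.3 Thm. 13.3.5 p. 202, Thm. 13.3.6 (c) p. 202, p. 199 ¶2; §13.2 p. 200 l. 1–3; §13.7 p. 206] [cite: CartierCorvallis1979, §IV.1 Cor. 4.1] -/
theorem xiRigidityGHom_of_marker_laws_of_meet
    {h : XiPacketsSignedHom 𝔩 𝔞 μ infOf aTok (transportAPackets ψ Pk') PkInf κ}
    (hKM1 : ∀ (v : HeightOneSpectrum (𝓞 ↥(maximalRealSubfield L))) (P P' : (𝔩 v).Pkt), (𝔩 v).mem P = (𝔩 v).mem P' → (∀ c, (𝔩 v).one P c = (𝔩 v).one P' c) →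
      (P ∈ aTok v ↔ P' ∈ aTok v) → P = P')
    (hKJ : ∀ (v : HeightOneSpectrum (𝓞 ↥(maximalRealSubfield L))) (P : (𝔩 v).Pkt) (c : IrrClass ((UnitaryGroup.cmDatum L 3 (splitForm L 3)).Local v)),
      c ∉ (𝔩 v).mem P → (𝔩 v).one P c = 0)
    (hKM2 : ∀ (ξ : OneDimAutRepH L) (v : HeightOneSpectrum (𝓞 ↥(maximalRealSubfield L))) (P : (𝔩 v).Pkt), P ∉ aTok v →
      (transportAPackets ψ Pk' ξ v).πn ∉ (𝔩 v).mem P)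
    (hKM3 : ∀ (ξ : OneDimAutRepH L) (v : HeightOneSpectrum (𝓞 ↥(maximalRealSubfield L))) (P : (𝔩 v).Pkt), P ∈ aTok v →
      ((transportAPackets ψ Pk' ξ v).πn ∈ (𝔩 v).mem P ∨ ∃ c, (transportAPackets ψ Pk' ξ v).πs = some c ∧ c ∈ (𝔩 v).mem P) →
      (∀ c, c ∈ (𝔩 v).mem P ↔ (c = (transportAPackets ψ Pk' ξ v).πn ∨ (transportAPackets ψ Pk' ξ v).πs = some c)) ∧
        (𝔩 v).one P (transportAPackets ψ Pk' ξ v).πn = 1 ∧ ∀ c ∈ (𝔩 v).mem P, c ≠ (transportAPackets ψ Pk' ξ v).πn → (𝔩 v).one P c = -1)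
    (h4 : ∀ v : HeightOneSpectrum (𝓞 ↥(maximalRealSubfield L)), (𝔩 v).UnramLaw)
    (hKG3 : ∀ (v : HeightOneSpectrum (𝓞 ↥(maximalRealSubfield L))) (P : (𝔩 v).Pkt), ∀ π ∈ (𝔩 v).mem P, π.IsAdmissible)
    (S₀ : Finset (HeightOneSpectrum (𝓞 ↥(maximalRealSubfield L))))
    (hψK : ∀ v ∉ S₀, (cmLocalIntegralLevel L 3 H v).map (ψ v : (cmDatum L 3 H).Local v →* (cmDatum L 3 (splitForm L 3)).Local v) =
      cmLocalIntegralLevel L 3 (splitForm L 3) v)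
    (hvol : ∀ v : HeightOneSpectrum (𝓞 ↥(maximalRealSubfield L)), (νG' v).real (cmLocalIntegralLevel L 3 H v : Set ((cmDatum L 3 H).Local v)) ≠ 0)
    (hsph : ∀ (ξ : OneDimAutRepH L), ∀ v ∉ ram ξ, (Pk' ξ v).πn.IsSpherical (cmLocalIntegralLevel L 3 H v))
    (hadmn : ∀ (ξ : OneDimAutRepH L) (v : HeightOneSpectrum (𝓞 ↥(maximalRealSubfield L))), (Pk' ξ v).πn.IsAdmissible)
    {tXi : OneDimAutRepH L → EvpData L H}
    (ht : ∀ (ξ : OneDimAutRepH L), ∀ v ∉ ram ξ, tXi ξ v = (Pk' ξ v).πn.eigencharacter (cmLocalIntegralLevel L 3 H v) (νG' v))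
    (hA : ∀ (ξ : OneDimAutRepH L) (S : Finset (HeightOneSpectrum (𝓞 ↥(maximalRealSubfield L)))) (Q : SpectralPacketG 𝔩 𝔞 μ),
      Q.inf = infOf Q.fin → (∀ v, Q.fin.loc v ∈ aTok v) → EqOff L H S (Q.evpGψ ψ (fun w => (νG' w).map (ψ w))) (tXi ξ) → Q.fin.ramFinset ⊆ S →
      ∀ v, (transportAPackets ψ Pk' ξ v).πn ∈ (𝔩 v).mem (Q.fin.loc v) ∨ ∃ c, (transportAPackets ψ Pk' ξ v).πs = some c ∧ c ∈ (𝔩 v).mem (Q.fin.loc v)) :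
    XiRigidityGHom h ψ (fun w => (νG' w).map (ψ w)) tXi :=
  xiRigidityGHom_of_marker_laws hKM1 hKJ hKM2 hKM3
    (fun ξ _ Q _ _ hevp hram => exists_transport_πn_mem_of_eqOff h4 hKG3 S₀ hψK hvol hsph hadmn ht ξ (Q := Q) hevp hram) hA

end Summit.HodgeConjecture.HodgeConjecture.Cruxes.H413.F0P3SpectralPacket.SpectralPacketG

end
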